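import Summits.Ventures.Crystal3D.Theorems.StickyWulffConstantCoaxialWallLawEndRowDefs
import Summits.Ventures.Crystal3D.Theorems.StickyWulffConstantGenericWallFloorTwinFrame
import HarnessLib

/-!
# The census row's predicates: from the exported witness pattern, and transport under cell isometries

HONEST FRAMING. Venture `Summits/Ventures/Crystal3D` (cell `crystal3d-full`), helper `--supports` the crux
`CoaxialWallLaw` (stmt-Ventures-19481, `route-Ventures-StickyWulffConstant`), REGISTERED line `WallLedgerF` (planner
cf-p1), open stub `stub_coaxialTwoSlabAdhesion`.  Rung credit only; F-C1 not moved.  STEP-2 of DECISION (xxxiii)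
(19481-p2 g6): plumbing between the export theorems (`…Nm` variants) and the census object of `…EndRowDefs`.

* `isEndMove_of_nm` — the exported non-moving witness pattern of a pair `(b, q)` (frame `G`, direction `d`) IS
  `IsEndMove X v1 G d q b`.
* `isFull_transport`, `isTwinReading_transport`, `isNarrow_transport`, `isMoving_transport`,
  `isEndMove_transport` — under a cell isometry `M x = S x + c` the predicates of a configuration `X'` at
  `(G, d, b)` become those of `X'.image M` at `(G ∘→ S, S d, M b)`; this is how the TOP plate's pairs, exported in the
  mirrored cell, are read in the original cell (frames of the top system are the mirrored frames post-composed
  with `S`).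

WHAT THIS IS NOT: not the stub; no counting here; F-C1 not moved.
-/

noncomputable section

namespace Summit.Ventures.Crystal3D.Theorems

open Summit.Ventures.Crystal3D Finset
open scoped InnerProductSpace

/-! ### From the exported pattern -/

/-- **The exported NON-MOVING witness pattern is `IsEndMove … v1`.** -/
theorem isEndMove_of_nm {X : Finset (EuclideanSpace ℝ (Fin 3))}
    {G : EuclideanSpace ℝ (Fin 3) ≃ₗᵢ[ℝ] EuclideanSpace ℝ (Fin 3)} {d b q : EuclideanSpace ℝ (Fin 3)}
    (h : ((∀ w ∈ fccSlots, q + G w ∈ X) ∧ b = q + d ∧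
          ¬ ((∀ w ∈ fccSlots, b + G w ∈ X) ∨
            ∃ m' : EuclideanSpace ℝ (Fin 3), ‖m'‖ = 1 ∧
              (∀ w ∈ fccSlots, ⟪G w, m'⟫_ℝ = 0 ∨ ⟪G w, m'⟫_ℝ = Real.sqrt (2 / 3) ∨ ⟪G w, m'⟫_ℝ = -Real.sqrt (2 / 3)) ∧
              (∀ w ∈ fccSlots, ⟪G w, m'⟫_ℝ ≤ 0 → b + G w ∈ X) ∧
              (∀ w ∈ fccSlots, ⟪G w, m'⟫_ℝ < 0 → b + (G w - (2 * ⟪G w, m'⟫_ℝ) • m') ∈ X) ∧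
              (∀ w ∈ fccSlots, 0 < ⟪G w, m'⟫_ℝ → b + G w ∉ X) ∧
              (⟪d, m'⟫_ℝ = Real.sqrt (2 / 3) ∨ ⟪d, m'⟫_ℝ = 0))) ∨
        ∃ m : EuclideanSpace ℝ (Fin 3), ‖m‖ = 1 ∧
          (∀ w ∈ fccSlots, ⟪G w, m⟫_ℝ = 0 ∨ ⟪G w, m⟫_ℝ = Real.sqrt (2 / 3) ∨ ⟪G w, m⟫_ℝ = -Real.sqrt (2 / 3)) ∧
          (∀ w ∈ fccSlots, ⟪G w, m⟫_ℝ ≤ 0 → q + G w ∈ X) ∧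
          (∀ w ∈ fccSlots, ⟪G w, m⟫_ℝ < 0 → q + (G w - (2 * ⟪G w, m⟫_ℝ) • m) ∈ X) ∧
          (∀ w ∈ fccSlots, 0 < ⟪G w, m⟫_ℝ → q + G w ∉ X) ∧
          ((⟪d, m⟫_ℝ = Real.sqrt (2 / 3) ∧ b = q - (d - (2 * ⟪d, m⟫_ℝ) • m) ∧
            ¬ ((∀ w ∈ fccSlots, b + (G w - (2 * ⟪G w, m⟫_ℝ) • m) ∈ X) ∨
              ∃ m' : EuclideanSpace ℝ (Fin 3), ‖m'‖ = 1 ∧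
                (∀ w ∈ fccSlots, ⟪G w - (2 * ⟪G w, m⟫_ℝ) • m, m'⟫_ℝ = 0 ∨
                  ⟪G w - (2 * ⟪G w, m⟫_ℝ) • m, m'⟫_ℝ = Real.sqrt (2 / 3) ∨
                  ⟪G w - (2 * ⟪G w, m⟫_ℝ) • m, m'⟫_ℝ = -Real.sqrt (2 / 3)) ∧
                (∀ w ∈ fccSlots, ⟪G w - (2 * ⟪G w, m⟫_ℝ) • m, m'⟫_ℝ ≤ 0 →
                  b + (G w - (2 * ⟪G w, m⟫_ℝ) • m) ∈ X) ∧
                (∀ w ∈ fccSlots, ⟪G w - (2 * ⟪G w, m⟫_ℝ) • m, m'⟫_ℝ < 0 →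
                  b + ((G w - (2 * ⟪G w, m⟫_ℝ) • m) - (2 * ⟪G w - (2 * ⟪G w, m⟫_ℝ) • m, m'⟫_ℝ) • m') ∈ X) ∧
                (∀ w ∈ fccSlots, 0 < ⟪G w - (2 * ⟪G w, m⟫_ℝ) • m, m'⟫_ℝ →
                  b + (G w - (2 * ⟪G w, m⟫_ℝ) • m) ∉ X) ∧
                (⟪-(d - (2 * ⟪d, m⟫_ℝ) • m), m'⟫_ℝ = Real.sqrt (2 / 3) ∨
                  ⟪-(d - (2 * ⟪d, m⟫_ℝ) • m), m'⟫_ℝ = 0))) ∨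
            (⟪d, m⟫_ℝ = 0 ∧ b = q + d ∧
            ¬ ((∀ w ∈ fccSlots, b + G w ∈ X) ∨
              ∃ m' : EuclideanSpace ℝ (Fin 3), ‖m'‖ = 1 ∧
                (∀ w ∈ fccSlots, ⟪G w, m'⟫_ℝ = 0 ∨ ⟪G w, m'⟫_ℝ = Real.sqrt (2 / 3) ∨ ⟪G w, m'⟫_ℝ = -Real.sqrt (2 / 3)) ∧
                (∀ w ∈ fccSlots, ⟪G w, m'⟫_ℝ ≤ 0 → b + G w ∈ X) ∧
                (∀ w ∈ fccSlots, ⟪G w, m'⟫_ℝ < 0 → b + (G w - (2 * ⟪G w, m'⟫_ℝ) • m') ∈ X) ∧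
                (∀ w ∈ fccSlots, 0 < ⟪G w, m'⟫_ℝ → b + G w ∉ X) ∧
                (⟪d, m'⟫_ℝ = Real.sqrt (2 / 3) ∨ ⟪d, m'⟫_ℝ = 0))))) :
    IsEndMove X WordVersion.v1 G d q b := by
  -- the non-moving clause in `IsMoving` form, same frame
  have hconv : ∀ (H : EuclideanSpace ℝ (Fin 3) ≃ₗᵢ[ℝ] EuclideanSpace ℝ (Fin 3)) (e : EuclideanSpace ℝ (Fin 3)),
      ¬ ((∀ w ∈ fccSlots, b + H w ∈ X) ∨
        ∃ m' : EuclideanSpace ℝ (Fin 3), ‖m'‖ = 1 ∧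
          (∀ w ∈ fccSlots, ⟪H w, m'⟫_ℝ = 0 ∨ ⟪H w, m'⟫_ℝ = Real.sqrt (2 / 3) ∨ ⟪H w, m'⟫_ℝ = -Real.sqrt (2 / 3)) ∧
          (∀ w ∈ fccSlots, ⟪H w, m'⟫_ℝ ≤ 0 → b + H w ∈ X) ∧
          (∀ w ∈ fccSlots, ⟪H w, m'⟫_ℝ < 0 → b + (H w - (2 * ⟪H w, m'⟫_ℝ) • m') ∈ X) ∧
          (∀ w ∈ fccSlots, 0 < ⟪H w, m'⟫_ℝ → b + H w ∉ X) ∧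
          (⟪e, m'⟫_ℝ = Real.sqrt (2 / 3) ∨ ⟪e, m'⟫_ℝ = 0)) →
      ¬ IsMoving X WordVersion.v1 H e b := by
    intro H e hn hmov
    rcases hmov with hf | ⟨m', ⟨⟨hm', hmenu⟩, hown, hmir, hfar⟩, hdm⟩ | ⟨hv, -⟩
    · exact hn (Or.inl hf)
    · exact hn (Or.inr ⟨m', hm', hmenu, hown, hmir, hfar, hdm⟩)
    · exact WordVersion.noConfusion hv
  rcases h with ⟨hfull, hb, hnm⟩ | ⟨m, hm, hmenu, hown, hmir, hfar, hcase⟩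
  · exact Or.inl ⟨Or.inl hfull, hb, hconv G d hnm⟩
  · rcases hcase with ⟨hcr, hb, hnmx⟩ | ⟨hgl, hb, hnm⟩
    · refine Or.inr ⟨m, ⟨⟨hm, hmenu⟩, hown, hmir, hfar⟩, hcr, hb, ?_⟩
      -- the mirrored class: frame `G ∘→ R_m`, direction `b − q = −R_m d`
      have hframe : ∀ w, (G.trans (ℝ ∙ m)ᗮ.reflection) w = G w - (2 * ⟪G w, m⟫_ℝ) • m := by
        intro w; rw [LinearIsometryEquiv.trans_apply, reflection_unit_apply hm]
      have hdir : b - q = -(d - (2 * ⟪d, m⟫_ℝ) • m) := by rw [hb]; abel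
      have key := hconv (G.trans (ℝ ∙ m)ᗮ.reflection) (b - q)
      simp only [hframe, hdir] at key
      rw [hdir]
      exact key hnmx
    · exact Or.inl ⟨Or.inr (Or.inr ⟨m, ⟨⟨hm, hmenu⟩, hown, hmir, hfar⟩, hgl⟩), hb, hconv G d hnm⟩

/-! ### Transport under a cell isometry `M x = S x + c` -/

section Transport

variable {X' : Finset (EuclideanSpace ℝ (Fin 3))} (S : EuclideanSpace ℝ (Fin 3) ≃ₗᵢ[ℝ] EuclideanSpace ℝ (Fin 3))
  (c : EuclideanSpace ℝ (Fin 3))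

/-- The cell isometry `x ↦ S x + c` is affine: `M b + S y = M (b + y)`. -/
theorem cellIso_add (b y : EuclideanSpace ℝ (Fin 3)) : S b + c + S y = S (b + y) + c := by
  rw [map_add]; abel

open scoped Classical in
/-- membership in the transported configuration -/
theorem mem_image_cellIso_iff (p : EuclideanSpace ℝ (Fin 3)) :
    S p + c ∈ X'.image (fun x => S x + c) ↔ p ∈ X' := by
  constructor
  · intro hp
    obtain ⟨x, hx, hxp⟩ := mem_image.1 hp
    have : x = p := S.injective (add_right_cancel hxp)
    rw [← this]; exact hx
  · intro hp; exact mem_image_of_mem _ hp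

/-- `IsMenuNormal` transports (both ways, the normal transported by `S`). -/
theorem isMenuNormal_transport_iff {G : EuclideanSpace ℝ (Fin 3) ≃ₗᵢ[ℝ] EuclideanSpace ℝ (Fin 3)}
    {m : EuclideanSpace ℝ (Fin 3)} : IsMenuNormal (G.trans S) (S m) ↔ IsMenuNormal G m := by
  unfold IsMenuNormal
  simp only [LinearIsometryEquiv.trans_apply, LinearIsometryEquiv.inner_map_map, LinearIsometryEquiv.norm_map]

open scoped Classical in
/-- `IsFull` transports. -/
theorem isFull_transport_iff {G : EuclideanSpace ℝ (Fin 3) ≃ₗᵢ[ℝ] EuclideanSpace ℝ (Fin 3)}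
    {b : EuclideanSpace ℝ (Fin 3)} :
    IsFull (X'.image fun x => S x + c) (G.trans S) (S b + c) ↔ IsFull X' G b := by
  unfold IsFull
  refine forall₂_congr fun w _ => ?_
  rw [LinearIsometryEquiv.trans_apply, cellIso_add, mem_image_cellIso_iff]

open scoped Classical in
/-- `IsTwinReading` transports. -/
theorem isTwinReading_transport_iff {G : EuclideanSpace ℝ (Fin 3) ≃ₗᵢ[ℝ] EuclideanSpace ℝ (Fin 3)}
    {m b : EuclideanSpace ℝ (Fin 3)} :
    IsTwinReading (X'.image fun x => S x + c) (G.trans S) (S m) (S b + c) ↔ IsTwinReading X' G m b := by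
  unfold IsTwinReading
  have e1 : ∀ w, S b + c + S (G w) = S (b + G w) + c := fun w => cellIso_add S c b (G w)
  have e2 : ∀ w, S b + c + (S (G w) - (2 * ⟪G w, m⟫_ℝ) • S m) = S (b + (G w - (2 * ⟪G w, m⟫_ℝ) • m)) + c := by
    intro w; rw [map_add, map_sub, LinearIsometryEquiv.map_smul]; abel
  simp only [isMenuNormal_transport_iff, LinearIsometryEquiv.trans_apply, LinearIsometryEquiv.inner_map_map, e1, e2,
    mem_image_cellIso_iff]

open scoped Classical in
/-- `IsNarrow` transports. -/
theorem isNarrow_transport_iff {G : EuclideanSpace ℝ (Fin 3) ≃ₗᵢ[ℝ] EuclideanSpace ℝ (Fin 3)}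
    {d b : EuclideanSpace ℝ (Fin 3)} :
    IsNarrow (X'.image fun x => S x + c) (G.trans S) (S d) (S b + c) ↔ IsNarrow X' G d b := by
  unfold IsNarrow
  have e1 : ∀ w, S b + c + S (G w) = S (b + G w) + c := fun w => cellIso_add S c b (G w)
  rw [cellIso_add, mem_image_cellIso_iff]
  refine and_congr Iff.rfl ⟨?_, ?_⟩
  · rintro ⟨m, hmn, hdm, hpos⟩
    refine ⟨S.symm m, ?_, ?_, fun w hw hp => ?_⟩
    · rw [← isMenuNormal_transport_iff S, LinearIsometryEquiv.apply_symm_apply]; exact hmn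
    · rw [← LinearIsometryEquiv.inner_map_map S, LinearIsometryEquiv.apply_symm_apply]; exact hdm
    · have := hpos w hw (by
        rw [LinearIsometryEquiv.trans_apply, ← LinearIsometryEquiv.apply_symm_apply S m,
          LinearIsometryEquiv.inner_map_map]; exact hp)
      rw [LinearIsometryEquiv.trans_apply, e1, mem_image_cellIso_iff] at this
      exact this
  · rintro ⟨m, hmn, hdm, hpos⟩
    refine ⟨S m, (isMenuNormal_transport_iff S).2 hmn, by rw [LinearIsometryEquiv.inner_map_map]; exact hdm,
      fun w hw hp => ?_⟩
    rw [LinearIsometryEquiv.trans_apply, e1, mem_image_cellIso_iff]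
    rw [LinearIsometryEquiv.trans_apply, LinearIsometryEquiv.inner_map_map] at hp
    exact hpos w hw hp

open scoped Classical in
/-- `IsMoving` transports. -/
theorem isMoving_transport_iff {v : WordVersion} {G : EuclideanSpace ℝ (Fin 3) ≃ₗᵢ[ℝ] EuclideanSpace ℝ (Fin 3)}
    {d b : EuclideanSpace ℝ (Fin 3)} :
    IsMoving (X'.image fun x => S x + c) v (G.trans S) (S d) (S b + c) ↔ IsMoving X' v G d b := by
  unfold IsMoving
  refine or_congr (isFull_transport_iff S c) (or_congr ⟨?_, ?_⟩ (and_congr Iff.rfl (isNarrow_transport_iff S c)))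
  · rintro ⟨m, htr, hdm⟩
    refine ⟨S.symm m, ?_, ?_⟩
    · rw [← isTwinReading_transport_iff S c, LinearIsometryEquiv.apply_symm_apply]; exact htr
    · rw [← LinearIsometryEquiv.inner_map_map S, LinearIsometryEquiv.apply_symm_apply]; exact hdm
  · rintro ⟨m, htr, hdm⟩
    exact ⟨S m, (isTwinReading_transport_iff S c).2 htr, by rw [LinearIsometryEquiv.inner_map_map]; exact hdm⟩

open scoped Classical in
/-- **`IsEndMove` transports** (forward): a pair of the configuration `X'` read in `X'.image (S · + c)` with the
frame post-composed with `S`. -/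
theorem isEndMove_transport {v : WordVersion} {G : EuclideanSpace ℝ (Fin 3) ≃ₗᵢ[ℝ] EuclideanSpace ℝ (Fin 3)}
    {d q b : EuclideanSpace ℝ (Fin 3)} (h : IsEndMove X' v G d q b) :
    IsEndMove (X'.image fun x => S x + c) v (G.trans S) (S d) (S q + c) (S b + c) := by
  rcases h with ⟨hmv, hb, hnm⟩ | ⟨m, htr, hcr, hb, hnm⟩
  · left
    refine ⟨?_, by rw [hb, cellIso_add], fun hmov => hnm ((isMoving_transport_iff S c).1 hmov)⟩
    rcases hmv with hf | ⟨hv, hn⟩ | ⟨m, htr, hgl⟩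
    · exact Or.inl ((isFull_transport_iff S c).2 hf)
    · exact Or.inr (Or.inl ⟨hv, (isNarrow_transport_iff S c).2 hn⟩)
    · exact Or.inr (Or.inr ⟨S m, (isTwinReading_transport_iff S c).2 htr,
        by rw [LinearIsometryEquiv.inner_map_map]; exact hgl⟩)
  · right
    have hm : ‖m‖ = 1 := htr.1.1
    have hSm : ‖S m‖ = 1 := by rw [LinearIsometryEquiv.norm_map, hm]
    refine ⟨S m, (isTwinReading_transport_iff S c).2 htr, by rw [LinearIsometryEquiv.inner_map_map]; exact hcr, ?_, ?_⟩
    · rw [hb, LinearIsometryEquiv.inner_map_map, map_sub, map_sub, LinearIsometryEquiv.map_smul]; abel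
    · -- the mirrored frames agree: `(G ∘→ R_m) ∘→ S = (G ∘→ S) ∘→ R_{S m}`
      have hfr : (G.trans (ℝ ∙ m)ᗮ.reflection).trans S = (G.trans S).trans (ℝ ∙ S m)ᗮ.reflection := by
        refine LinearIsometryEquiv.ext fun x => ?_
        simp only [LinearIsometryEquiv.trans_apply]
        rw [reflection_unit_apply hm, reflection_unit_apply hSm, map_sub, LinearIsometryEquiv.map_smul,
          LinearIsometryEquiv.inner_map_map]
      have hdir : S b + c - (S q + c) = S (b - q) := by rw [map_sub]; abel
      rw [hdir, ← hfr]
      exact fun hmov => hnm ((isMoving_transport_iff S c).1 hmov)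

end Transport

end Summit.Ventures.Crystal3D.Theorems

end
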